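import Mathlib.Algebra.Order.BigOperators.Group.Finset
import Mathlib.Combinatorics.Enumerative.DoubleCounting
import Summits.CriticalPhenomena.PercolationContinuityZ3.Theorems.PercNearOneGluingNoHeavyLowerTailSahiCTCKleitmanDegree
import HarnessLib

/-!
# `NoHeavyLowerTail` (crux stmt-CriticalPhenomena-4575), P3 lane: the DENSITY lemma for the Kleitman surplus of two 2-live up-sets (memo g25 §2)

Support file (seat `prim-l12-p3`, gen 25; `--supports stmt-CriticalPhenomena-4575`).  Continues `…SahiCTCKleitmanSurplus` / `…SahiCTCKleitmanDegree`.
For 2-live up-sets `𝒳, 𝒵` and a finset `s` with `#s ≥ 3`, with `W = cedges 𝒳 𝒵 s` the common 2-sets inside `s`: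
* `sum_degree_cedges` (handshake), `density_step_arith` (the arithmetic of the induction step),
* `density_le_kap` (DENSITY): `(#s + 1)·#W ≤ C(#s,2)·κ(∅,s)` — induction on `#s` peeling a vertex of minimum common degree (vertex recursion +
  LOOP lemma + handshake); equality at `𝒳 = 𝒵 = {all sets of size ≥ 2}`.
Nothing is asserted about the crux.
-/

namespace Summit.CriticalPhenomena.PercolationContinuityZ3.Theorems.SahiCTCForms

open Finset

variable {α : Type*} [DecidableEq α]

section Density
variable {𝒳 𝒵 : Finset (Finset α)} {s : Finset α}

/-- Membership in `cedges`. [this work] -/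
theorem mem_cedges {e : Finset α} : e ∈ cedges 𝒳 𝒵 s ↔ e ⊆ s ∧ #e = 2 ∧ e ∈ 𝒳 ∧ e ∈ 𝒵 := by
  unfold cedges; rw [mem_filter, mem_powerset]

/-- Common 2-sets inside `s` are common members of the restrictions. [this work] -/
theorem cedges_subset_tr_inter : cedges 𝒳 𝒵 s ⊆ tr 𝒳 ∅ s ∩ tr 𝒵 ∅ s := fun e he => by
  obtain ⟨hes, _, hX, hZ⟩ := mem_cedges.1 he
  exact mem_inter.2 ⟨mem_tr_empty.2 ⟨hes, hX⟩, mem_tr_empty.2 ⟨hes, hZ⟩⟩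

/-- The common edges inside `s − v` are the common edges inside `s` avoiding `v`. [this work] -/
theorem cedges_erase (v : α) : cedges 𝒳 𝒵 (s.erase v) = (cedges 𝒳 𝒵 s).filter fun e => v ∉ e := by
  ext e; simp only [mem_cedges, mem_filter, subset_erase]; tauto

/-- Handshake: `Σ_{u ∈ s} deg_W(u) = 2·#W` for the common-edge graph `W` on `s`. [folklore] -/
theorem sum_degree_cedges : ∑ u ∈ s, #((cedges 𝒳 𝒵 s).filter fun e => u ∈ e) = 2 * #(cedges 𝒳 𝒵 s) := by
  have h := sum_card_bipartiteAbove_eq_sum_card_bipartiteBelow (s := s) (t := cedges 𝒳 𝒵 s) (r := fun u e => u ∈ e)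
  simp only [bipartiteAbove, bipartiteBelow] at h
  rw [h]
  have : ∀ e ∈ cedges 𝒳 𝒵 s, #(s.filter fun u => u ∈ e) = 2 := fun e he => by
    obtain ⟨hes, he2, _⟩ := mem_cedges.1 he
    rw [filter_mem_eq_inter, inter_eq_right.2 hes, he2]
  rw [sum_congr rfl this, sum_const]; simp [mul_comm]

/-- The arithmetic of the density induction step (in `ℚ`-free integer form). [this work] -/
theorem density_step_arith (m δ w : ℕ) (k k0 : ℤ) (hm : 4 ≤ m)
    (hIH : (m : ℤ) * ((w : ℤ) - δ) ≤ ((m - 1).choose 2 : ℤ) * k0) (hhand : m * δ ≤ 2 * w) (hδm : δ ≤ m - 1)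
    (hk : k0 + (if 0 < δ then 1 else 0) ≤ k) :
    ((m : ℤ) + 1) * w ≤ (m.choose 2 : ℤ) * k := by
  -- closed forms of the binomials
  have hc2 : (m.choose 2 : ℤ) * 2 = m * (m - 1) := by
    have := Nat.choose_two_right m
    have h2 : m * (m - 1) = m.choose 2 * 2 := by
      rw [this]; exact (Nat.div_mul_cancel (Nat.even_mul_pred_self m).two_dvd).symm
    have h1 : (1 : ℕ) ≤ m := by omega
    have := congrArg (fun x : ℕ => (x : ℤ)) h2
    push_cast [Nat.cast_sub h1] at this; linarith
  have hc2' : ((m - 1).choose 2 : ℤ) * 2 = (m - 1) * (m - 2) := by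
    have := Nat.choose_two_right (m - 1)
    have h2 : (m - 1) * (m - 1 - 1) = (m - 1).choose 2 * 2 := by
      rw [this]; exact (Nat.div_mul_cancel (Nat.even_mul_pred_self (m - 1)).two_dvd).symm
    have h1 : (2 : ℕ) ≤ m := by omega
    have := congrArg (fun x : ℕ => (x : ℤ)) h2
    have e1 : ((m - 1 : ℕ) : ℤ) = m - 1 := by push_cast [Nat.cast_sub (by omega : 1 ≤ m)]; ring
    have e2 : ((m - 1 - 1 : ℕ) : ℤ) = m - 2 := by
      rw [show m - 1 - 1 = m - 2 from by omega]; push_cast [Nat.cast_sub h1]; ring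
    push_cast [e1, e2] at this ⊢; linarith
  have hM : (4 : ℤ) ≤ m := by exact_mod_cast hm
  have hδm' : (δ : ℤ) ≤ m - 1 := by
    have h1 : (1 : ℕ) ≤ m := by omega
    have := (Nat.cast_le (α := ℤ)).2 hδm; push_cast [Nat.cast_sub h1] at this; exact this
  have hhand' : (m : ℤ) * δ ≤ 2 * w := by exact_mod_cast hhand
  -- it suffices to prove the inequality multiplied by (m-2) > 0, with 2·C(m,2) = m(m-1)
  have hpos : (0 : ℤ) < (m : ℤ) - 2 := by linarith
  suffices h : ((m : ℤ) - 2) * (2 * (((m : ℤ) + 1) * w)) ≤ ((m : ℤ) - 2) * (2 * ((m.choose 2 : ℤ) * k)) by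
    have := le_of_mul_le_mul_left h hpos; linarith
  have eR : ((m : ℤ) - 2) * (2 * ((m.choose 2 : ℤ) * k)) = (m - 2) * k * (m * (m - 1)) := by rw [← hc2]; ring
  rw [eR]
  have S2 : 2 * ((m : ℤ) * ((w : ℤ) - δ)) ≤ ((m : ℤ) - 1) * (m - 2) * k0 :=
    calc 2 * ((m : ℤ) * ((w : ℤ) - δ)) ≤ 2 * (((m - 1).choose 2 : ℤ) * k0) := by linarith
      _ = (((m - 1).choose 2 : ℤ) * 2) * k0 := by ring
      _ = ((m : ℤ) - 1) * (m - 2) * k0 := by rw [hc2']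
  have S2m : 0 ≤ (m : ℤ) * (((m : ℤ) - 1) * (m - 2) * k0 - 2 * ((m : ℤ) * ((w : ℤ) - δ))) :=
    mul_nonneg (by linarith) (by linarith)
  by_cases hδ0 : 0 < δ
  · rw [if_pos hδ0] at hk
    have S1 : 0 ≤ ((m : ℤ) - 2) * m * (m - 1) * (k - k0 - 1) :=
      mul_nonneg (mul_nonneg (mul_nonneg (by linarith) (by linarith)) (by linarith)) (by linarith)
    have S3 : 0 ≤ (m : ℤ) * (m - 2) * (m - 1 - δ) := mul_nonneg (mul_nonneg (by linarith) (by linarith)) (by linarith)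
    have S4 : 0 ≤ (2 * (w : ℤ) - m * δ) * (m + 2) := mul_nonneg (by linarith) (by linarith)
    linarith
  · rw [if_neg hδ0] at hk
    have hδz : (δ : ℤ) = 0 := by exact_mod_cast (Nat.eq_zero_of_not_pos hδ0)
    rw [hδz] at S2m
    have hw0 : (0 : ℤ) ≤ w := Nat.cast_nonneg _
    have T1 : 0 ≤ ((m : ℤ) - 2) * m * (m - 1) * (k - k0) :=
      mul_nonneg (mul_nonneg (mul_nonneg (by linarith) (by linarith)) (by linarith)) (by linarith)
    have T3 : 0 ≤ 2 * (w : ℤ) * (m + 2) := mul_nonneg (by linarith) (by linarith)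
    linarith

/-- **DENSITY lemma**: for 2-live up-sets and `#s ≥ 3`, `(#s + 1)·#W ≤ C(#s,2)·κ(∅,s)` (`W` = common edges inside `s`). [this work] -/
theorem density_le_kap (h𝒳 : IsUpperSet (𝒳 : Set (Finset α))) (h𝒵 : IsUpperSet (𝒵 : Set (Finset α)))
    (hX2 : ∀ U ∈ 𝒳, 2 ≤ #U) (hZ2 : ∀ U ∈ 𝒵, 2 ≤ #U) :
    ∀ (n : ℕ) (s : Finset α), #s = n → 3 ≤ #s →
      ((#s : ℤ) + 1) * #(cedges 𝒳 𝒵 s) ≤ ((#s).choose 2 : ℤ) * kap 𝒳 𝒵 ∅ s := by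
  intro n
  induction n using Nat.strong_induction_on with
  | _ n ih =>
  intro s hsn hs3
  have hk0 : 0 ≤ kap 𝒳 𝒵 ∅ s := kap_nonneg h𝒳 h𝒵 s ∅ (disjoint_empty_left s)
  by_cases h3 : #s = 3
  · -- base: κ = #(common members) ≥ #W + [W ≠ ∅], and #W ≤ 3
    rw [kap_empty_eq_card_of_card_le_three hX2 hZ2 h3.le, h3]
    have hWle : #(cedges 𝒳 𝒵 s) ≤ 3 := by
      have : cedges 𝒳 𝒵 s ⊆ s.powersetCard 2 := fun e he => by
        obtain ⟨hes, he2, _⟩ := mem_cedges.1 he; exact mem_powersetCard.2 ⟨hes, he2⟩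
      have h := card_le_card this
      rw [card_powersetCard, h3] at h
      exact h
    have hW3 : (#(cedges 𝒳 𝒵 s) : ℤ) ≤ 3 := by exact_mod_cast hWle
    have hT0 : (0 : ℤ) ≤ #(tr 𝒳 ∅ s ∩ tr 𝒵 ∅ s) := Nat.cast_nonneg _
    have hc3 : ((Nat.choose 3 2 : ℕ) : ℤ) = 3 := by rw [show Nat.choose 3 2 = 3 from rfl]; rfl
    rw [hc3]
    by_cases hW : cedges 𝒳 𝒵 s = ∅
    · rw [hW, card_empty, Nat.cast_zero, mul_zero]; positivity
    · obtain ⟨e, he⟩ := nonempty_iff_ne_empty.2 hW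
      obtain ⟨hes, he2, hX, hZ⟩ := mem_cedges.1 he
      have hsmem : s ∈ tr 𝒳 ∅ s ∩ tr 𝒵 ∅ s :=
        mem_inter.2 ⟨mem_tr_empty.2 ⟨Subset.rfl, h𝒳 hes hX⟩, mem_tr_empty.2 ⟨Subset.rfl, h𝒵 hes hZ⟩⟩
      have hsnot : s ∉ cedges 𝒳 𝒵 s := fun h => by have := (mem_cedges.1 h).2.1; omega
      have hcard := card_le_card (insert_subset hsmem cedges_subset_tr_inter)
      rw [card_insert_of_notMem hsnot] at hcard
      have : (#(cedges 𝒳 𝒵 s) : ℤ) + 1 ≤ #(tr 𝒳 ∅ s ∩ tr 𝒵 ∅ s) := by exact_mod_cast hcard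
      push_cast; nlinarith
  -- step: #s ≥ 4, v of minimum common degree δ
  have hs4 : 4 ≤ #s := by omega
  have hsne : s.Nonempty := card_pos.1 (by omega)
  obtain ⟨v, hv, hmin⟩ := exists_min_image s (fun u => #((cedges 𝒳 𝒵 s).filter fun e => u ∈ e)) hsne
  -- handshake: #s·δ ≤ 2·#W
  have hhand : #s * #((cedges 𝒳 𝒵 s).filter fun e => v ∈ e) ≤ 2 * #(cedges 𝒳 𝒵 s) := by
    have h1 := card_nsmul_le_sum s (fun u => #((cedges 𝒳 𝒵 s).filter fun e => u ∈ e)) _ fun u hu => hmin u hu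
    rw [sum_degree_cedges] at h1; simpa using h1
  -- δ ≤ #s − 1: the edges at v, with v erased, are distinct points... distinct subsets of s − v of size 1
  have hδle : #((cedges 𝒳 𝒵 s).filter fun e => v ∈ e) ≤ #s - 1 := by
    have h := card_le_card_of_injOn (fun e => e.erase v) (fun e he => ?_) (fun e he e' he' h => ?_)
      (s := (cedges 𝒳 𝒵 s).filter fun e => v ∈ e) (t := (s.erase v).powersetCard 1)
    · rwa [card_powersetCard, card_erase_of_mem hv, Nat.choose_one_right] at h
    · obtain ⟨heW, hve⟩ := mem_filter.1 (Finset.mem_coe.1 he)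
      obtain ⟨hes, he2, _⟩ := mem_cedges.1 heW
      refine Finset.mem_coe.2 (mem_powersetCard.2 ⟨fun x hx => ?_, by rw [card_erase_of_mem hve, he2]⟩)
      exact mem_erase.2 ⟨ne_of_mem_erase hx, hes (mem_of_mem_erase hx)⟩
    · have h1 : v ∈ e := (mem_filter.1 (Finset.mem_coe.1 he)).2
      have h2 : v ∈ e' := (mem_filter.1 (Finset.mem_coe.1 he')).2
      have h' : e.erase v = e'.erase v := h
      rw [← insert_erase h1, h', insert_erase h2]
  -- the deletion cube and the recursion
  have hrec := kap_rec (𝒳 := 𝒳) (𝒵 := 𝒵) h𝒳 h𝒵 hv (notMem_empty v)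
  rw [insert_empty] at hrec
  have hcardW : #(cedges 𝒳 𝒵 s) = #(cedges 𝒳 𝒵 (s.erase v)) + #((cedges 𝒳 𝒵 s).filter fun e => v ∈ e) := by
    rw [cedges_erase, ← card_filter_add_card_filter_not (s := cedges 𝒳 𝒵 s) (fun e => v ∉ e)]
    congr 2; ext e; simp only [mem_filter, not_not]
  have hs' : #(s.erase v) = n - 1 := by rw [card_erase_of_mem hv, hsn]
  have hIH := ih (n - 1) (by omega) (s.erase v) hs' (by omega)
  rw [hs'] at hIH
  -- κ({v}, s−v) ≥ [δ ≥ 1]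
  have hk1 : 0 ≤ kap 𝒳 𝒵 {v} (s.erase v) := by
    have := kap_nonneg h𝒳 h𝒵 (s.erase v) {v} (by simp)
    exact this
  have hloop : 0 < #((cedges 𝒳 𝒵 s).filter fun e => v ∈ e) → 1 ≤ kap 𝒳 𝒵 {v} (s.erase v) := fun hδ => by
    obtain ⟨e, he⟩ := card_pos.1 hδ
    obtain ⟨heW, hve⟩ := mem_filter.1 he
    obtain ⟨hes, he2, hX, hZ⟩ := mem_cedges.1 heW
    obtain ⟨x, y, hxy, rfl⟩ := card_eq_two.1 he2
    have hvX : ({v} : Finset α) ∉ 𝒳 := fun h => by have := hX2 _ h; simp at this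
    have hvZ : ({v} : Finset α) ∉ 𝒵 := fun h => by have := hZ2 _ h; simp at this
    simp only [mem_insert, mem_singleton] at hve
    rcases hve with rfl | rfl
    · -- v = x, the other endpoint is y
      have hy : y ∈ s.erase v := mem_erase.2 ⟨hxy.symm, hes (by simp)⟩
      have e1 : insert y ({v} : Finset α) = {v, y} := pair_comm y v
      exact one_le_kap_of_loop h𝒳 h𝒵 hvX hvZ hy (e1 ▸ hX) (e1 ▸ hZ)
    · have hx : x ∈ s.erase v := mem_erase.2 ⟨hxy, hes (by simp)⟩
      exact one_le_kap_of_loop h𝒳 h𝒵 hvX hvZ hx hX hZ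
  -- arithmetic
  have hχ : (0 : ℤ) ≤ #((tr 𝒳 {v} (s.erase v) \ tr 𝒳 ∅ (s.erase v)).filter fun R =>
      s.erase v \ R ∈ tr 𝒵 {v} (s.erase v) ∧ s.erase v \ R ∉ tr 𝒵 ∅ (s.erase v)) := Nat.cast_nonneg _
  have hk : kap 𝒳 𝒵 ∅ (s.erase v) + (if 0 < #((cedges 𝒳 𝒵 s).filter fun e => v ∈ e) then 1 else 0) ≤ kap 𝒳 𝒵 ∅ s := by
    split_ifs with hδ
    · have := hloop hδ; linarith
    · linarith
  rw [hsn] at hs4 hδle hhand ⊢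
  refine density_step_arith n _ _ _ _ hs4 ?_ hhand hδle hk
  have e : ((#(cedges 𝒳 𝒵 s) : ℤ) - #((cedges 𝒳 𝒵 s).filter fun e => v ∈ e)) = #(cedges 𝒳 𝒵 (s.erase v)) := by
    rw [hcardW]; push_cast; ring
  rw [e]
  have e2 : ((n - 1 : ℕ) : ℤ) + 1 = n := by
    have : 1 ≤ n := by omega
    push_cast [Nat.cast_sub this]; ring
  rw [e2] at hIH; exact hIH

end Density

end Summit.CriticalPhenomena.PercolationContinuityZ3.Theorems.SahiCTCForms
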